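/-
Copyright: the b2b-balaban T⁴-continuum CRUX team, row NE7b OWNER lineage `t4-ne7b-p1` (gen 144). Project licence.
-/
import Summits.QuantumFields.BalabanUV.T4Continuum.Spine.NE7b.SupThirdFormDifferentiable
import Summits.QuantumFields.BalabanUV.T4Continuum.Spine.NE7b.SupFourthFormDifferentiable

/-!
# THE COVECTOR `ψ ↦ fderiv(T(·)[h,k,l])ψ` IS FRÉCHET-DIFFERENTIABLE — SECOND-ORDER DIFFERENTIABILITY OF THE THIRD-DERIVATIVE ENTRIES
# (the `C⁵` repackaging, SCOPING-d16 §B (B), first half; (533) one order up).  (533)'s order-4 object is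
# `Q(ψ) = Σ_{x′y′z′} (fderiv(T(·)[e_x′,e_y′,e_z′])ψ)·b_{x′y′z′}`; to differentiate `Q` in `ψ` one differentiates each covector
# `ψ ↦ fderiv(T(·)[h,k,l])ψ ∈ E^*`.  Here: (§1) every covector on `E = ℝ^ι` expands in the coordinate basis, `L = Σ_n L(e_n)·proj_n`;
# (§2) THE END: `ψ ↦ fderiv(T(·)[h,k,l])ψ` `HasFDerivAt` every `ψ₀`, with derivative `Σ_n (fderiv of the entry ψ ↦ fderiv(T(·)[h,k,l])ψ[e_n])(ψ₀)
# · proj_n` — each entry equals (521)'s centred display at EVERY `ψ` ((532) `fderiv_third_form_apply`), which is `DifferentiableAt` by (637)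
# `differentiableAt_fourth_form`; then `HasFDerivAt.fun_sum` of `HasFDerivAt.smul_const` (row NE7b, node U5c; (532), (637) BY NAME; [folklore]).
# USE (§B (B) second half, (C)): compose with the constant linear maps `L ↦ L.smulRight b_{x′y′z′}` and sum over `x′,y′,z′` to get
# `HasFDerivAt Q P(ψ₀) ψ₀`; the entries of `P(ψ₀)` are the `fderiv`s (= `lineDeriv`s) of the centred display that (600)∕(610) bound.

Cell `pub-balaban`, sub-cell `t4`, spine estimate NE7b (`T4WeightBudget.RelWeightBound`; the cell's OWN estimate — NOT PRINTED in
[Bałaban 1983–89], NOT PROVED).  Crux-route work under `Spine/NE7b/` by the row OWNER (`t4-ne7b-p1` gen 144, file (638)) under FREEZE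
(0)'s crux-prover clause; NOTHING of Bałaban's is named as a Lean object, valued or asserted; no `T4Continuum/Support` leaf typed; no
`def`, no notation; zero `sorry`.  Imports (BY NAME): the OWNER's (532) `…SupThirdFormDifferentiable` (`fderiv_third_form_apply`) and (637)
`…SupFourthFormDifferentiable` (`differentiableAt_fourth_form`).

WHAT IS PROVED ([folklore]): §1 `covector_expand`; §2 THE END **`hasFDerivAt_fderiv_third_form`**; §3 toy.

HONEST (what this is NOT).  The covector of ONE entry triple `(h,k,l)`; the CLM-valued `HasFDerivAt Q P(ψ₀) ψ₀` (sum over the basis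
triples composed with `smulRight`), the identification of `P`'s entries with (600)∕(610)'s `lineDeriv`s and the order-5 packaging ((535)′)
are NOT here; continuity of `P` NOT typed; `U ∈ C⁵` with bounded derivatives and the regulator are hypotheses; scalar skeleton ((A3),
NC-NE7b-α UNRULED); nothing of Bałaban's asserted.  BY-NAME EFFECT ON THE WALL: NONE.  NE7b NOT PRINTED ∕ NOT PROVED; spine PROVED 0∕9;
rung (B)+1 — the programme's measures remain FINITE-torus statements; NOT the mass gap, NOT Clay.  HONEST DEPENDENCY: continuum YM on
T⁴ ⇐ BetaPertH ∧ nine spine estimates (0∕9 proved); BetaPertH ⇐ (D1) ∧ (D4) ∧ CAP+tail; G-an2-4 gates asym, D1 and NE2∕3∕4.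
-/

set_option autoImplicit false
set_option maxSynthPendingDepth 4

noncomputable section

namespace Summit.QuantumFields.BalabanUV.T4Continuum.NE7b.SupFourthFormCovectorFDeriv

open MeasureTheory ProbabilityTheory Finset Real Matrix
open scoped Topology
open SupThirdFormDifferentiable (fderiv_third_form_apply)
open SupFourthFormDifferentiable (differentiableAt_fourth_form)

variable {ι : Type} [Fintype ι] [DecidableEq ι]

/-! ## §1. Coordinate expansion of a covector -/

/-- **Every covector on `ℝ^ι` expands in the coordinate basis**: `L = Σ_n L(e_n)·proj_n`. [folklore] -/
theorem covector_expand (L : EuclideanSpace ℝ ι →L[ℝ] ℝ) :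
    L = ∑ n : ι, L (EuclideanSpace.single n (1 : ℝ)) • (EuclideanSpace.proj n : EuclideanSpace ℝ ι →L[ℝ] ℝ) := by
  ext v
  have hv : v = ∑ n : ι, v n • EuclideanSpace.single n (1 : ℝ) := by
    simpa using ((EuclideanSpace.basisFun ι ℝ).sum_repr v).symm
  conv_lhs => rw [hv]
  rw [map_sum, _root_.sum_apply]
  refine Finset.sum_congr rfl fun n _ => ?_
  rw [map_smul, smul_eq_mul, _root_.smul_apply, smul_eq_mul, mul_comm]
  rfl

section Main

variable {Γ : Matrix ι ι ℝ} {γop : ℝ} {U : EuclideanSpace ℝ ι → ℝ} {U' : EuclideanSpace ℝ ι → EuclideanSpace ℝ ι →L[ℝ] ℝ}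
  {U'' : EuclideanSpace ℝ ι → EuclideanSpace ℝ ι →L[ℝ] EuclideanSpace ℝ ι →L[ℝ] ℝ}
  {U₃ : EuclideanSpace ℝ ι → EuclideanSpace ℝ ι →L[ℝ] EuclideanSpace ℝ ι →L[ℝ] EuclideanSpace ℝ ι →L[ℝ] ℝ}
  {U₄ : EuclideanSpace ℝ ι → EuclideanSpace ℝ ι →L[ℝ] EuclideanSpace ℝ ι →L[ℝ] EuclideanSpace ℝ ι →L[ℝ]
    EuclideanSpace ℝ ι →L[ℝ] ℝ}
  {U₅ : EuclideanSpace ℝ ι → EuclideanSpace ℝ ι →L[ℝ] EuclideanSpace ℝ ι →L[ℝ] EuclideanSpace ℝ ι →L[ℝ]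
    EuclideanSpace ℝ ι →L[ℝ] EuclideanSpace ℝ ι →L[ℝ] ℝ}
  {κ₀ κ₁ a τ δ θ κ₂ κ₃ κ₄ κ₅ : ℝ} {h k l : EuclideanSpace ℝ ι}

/-! ## §2. The covector of a third-derivative entry is differentiable in the background -/

set_option maxHeartbeats 4000000 in
/-- **THE END: `ψ ↦ fderiv(T(·)[h,k,l])ψ` HAS A FRÉCHET DERIVATIVE AT EVERY `ψ₀`**, namely `Σ_n (fderiv (ψ ↦ fderiv(T(·)[h,k,l])ψ[e_n]) ψ₀)
· proj_n` (directions of norm `≤ 1`, `U ∈ C⁵` with bounded `U″…U⁽⁵⁾` under the regulator) — (532) entrywise at every `ψ`, (637), §1.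
[folklore] -/
theorem hasFDerivAt_fderiv_third_form (hΓ : Γ.PosSemidef) (hΓop : (γop • (1 : Matrix ι ι ℝ) - Γ).PosSemidef) (Y : Finset ι)
    (hUd : ∀ φ : EuclideanSpace ℝ ι, HasFDerivAt U (U' φ) φ) (hU'd : ∀ φ : EuclideanSpace ℝ ι, HasFDerivAt U' (U'' φ) φ)
    (hU''d : ∀ φ : EuclideanSpace ℝ ι, HasFDerivAt U'' (U₃ φ) φ) (hU₃d : ∀ φ : EuclideanSpace ℝ ι, HasFDerivAt U₃ (U₄ φ) φ)
    (hU₄d : ∀ φ : EuclideanSpace ℝ ι, HasFDerivAt U₄ (U₅ φ) φ) (hU₅c : Continuous U₅) (hκ₀ : 0 ≤ κ₀) (hκ₁ : 0 ≤ κ₁) (ha : 0 ≤ a)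
    (hτ : 0 < τ) (hδ : 0 < δ) (hθ1 : θ < 1) (hκθ : (2 * κ₀ * (1 + τ) + 4 * δ) * γop ≤ θ)
    (hstab : ∀ φ : EuclideanSpace ℝ ι, -(κ₀ * ∑ x ∈ Y, φ x ^ 2) ≤ U φ) (hU'b : ∀ φ : EuclideanSpace ℝ ι, ‖U' φ‖ ≤ κ₁ * (a + ∑ x ∈ Y, φ x ^ 2))
    (hθ0 : 0 < θ) (hU''b : ∀ φ : EuclideanSpace ℝ ι, ‖U'' φ‖ ≤ κ₂) (hU₃b : ∀ φ : EuclideanSpace ℝ ι, ‖U₃ φ‖ ≤ κ₃)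
    (hU₄b : ∀ φ : EuclideanSpace ℝ ι, ‖U₄ φ‖ ≤ κ₄) (hU₅b : ∀ φ : EuclideanSpace ℝ ι, ‖U₅ φ‖ ≤ κ₅) (ψ₀ : EuclideanSpace ℝ ι) (hh : ‖h‖ ≤ 1)
    (hk : ‖k‖ ≤ 1) (hl : ‖l‖ ≤ 1) :
    HasFDerivAt (fun ψ : EuclideanSpace ℝ ι => fderiv ℝ (fun ψ' : EuclideanSpace ℝ ι => ((∫ ω : EuclideanSpace ℝ ι, exp (-U (ω + ψ'))
        ∂(multivariateGaussian 0 Γ)))⁻¹ * (∫ ω : EuclideanSpace ℝ ι, exp (-U (ω + ψ')) * (U₃ (ω + ψ') h k l - U' (ω + ψ') k * U'' (ω + ψ') h l - U''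
        (ω + ψ') h k * U' (ω + ψ') l - U' (ω + ψ') h * U'' (ω + ψ') k l + U' (ω + ψ') h * U' (ω + ψ') k * U' (ω + ψ') l) ∂(multivariateGaussian 0
        Γ)) + ((∫ ω : EuclideanSpace ℝ ι, exp (-U (ω + ψ')) ∂(multivariateGaussian 0 Γ)) ^ 2)⁻¹ * (∫ ω : EuclideanSpace ℝ ι, exp (-U (ω + ψ')) * U'
        (ω + ψ') h ∂(multivariateGaussian 0 Γ)) * (∫ ω : EuclideanSpace ℝ ι, exp (-U (ω + ψ')) * (U'' (ω + ψ') k l - U' (ω + ψ') k * U' (ω + ψ') l)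
        ∂(multivariateGaussian 0 Γ)) + ((∫ ω : EuclideanSpace ℝ ι, exp (-U (ω + ψ')) ∂(multivariateGaussian 0 Γ)) ^ 2)⁻¹ * (∫ ω : EuclideanSpace ℝ
        ι, exp (-U (ω + ψ')) * U' (ω + ψ') k ∂(multivariateGaussian 0 Γ)) * (∫ ω : EuclideanSpace ℝ ι, exp (-U (ω + ψ')) * (U'' (ω + ψ') h l - U' (ω
        + ψ') h * U' (ω + ψ') l) ∂(multivariateGaussian 0 Γ)) + (((∫ ω : EuclideanSpace ℝ ι, exp (-U (ω + ψ')) ∂(multivariateGaussian 0 Γ)) ^ 2)⁻¹ *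
        (∫ ω : EuclideanSpace ℝ ι, exp (-U (ω + ψ')) * (U'' (ω + ψ') h k - U' (ω + ψ') h * U' (ω + ψ') k) ∂(multivariateGaussian 0 Γ)) + -2 / (∫ ω :
        EuclideanSpace ℝ ι, exp (-U (ω + ψ')) ∂(multivariateGaussian 0 Γ)) ^ 3 * -(∫ ω : EuclideanSpace ℝ ι, exp (-U (ω + ψ')) * U' (ω + ψ') h
        ∂(multivariateGaussian 0 Γ)) * (∫ ω : EuclideanSpace ℝ ι, exp (-U (ω + ψ')) * U' (ω + ψ') k ∂(multivariateGaussian 0 Γ))) * (∫ ω :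
        EuclideanSpace ℝ ι, exp (-U (ω + ψ')) * U' (ω + ψ') l ∂(multivariateGaussian 0 Γ))) ψ) (∑ n : ι, (fderiv ℝ (fun ψ : EuclideanSpace ℝ ι =>
        (fderiv ℝ (fun ψ' : EuclideanSpace ℝ ι => ((∫ ω : EuclideanSpace ℝ ι, exp (-U (ω + ψ')) ∂(multivariateGaussian 0 Γ)))⁻¹ * (∫ ω :
        EuclideanSpace ℝ ι, exp (-U (ω + ψ')) * (U₃ (ω + ψ') h k l - U' (ω + ψ') k * U'' (ω + ψ') h l - U'' (ω + ψ') h k * U' (ω + ψ') l - U' (ω +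
        ψ') h * U'' (ω + ψ') k l + U' (ω + ψ') h * U' (ω + ψ') k * U' (ω + ψ') l) ∂(multivariateGaussian 0 Γ)) + ((∫ ω : EuclideanSpace ℝ ι, exp (-U
        (ω + ψ')) ∂(multivariateGaussian 0 Γ)) ^ 2)⁻¹ * (∫ ω : EuclideanSpace ℝ ι, exp (-U (ω + ψ')) * U' (ω + ψ') h ∂(multivariateGaussian 0 Γ)) *
        (∫ ω : EuclideanSpace ℝ ι, exp (-U (ω + ψ')) * (U'' (ω + ψ') k l - U' (ω + ψ') k * U' (ω + ψ') l) ∂(multivariateGaussian 0 Γ)) + ((∫ ω :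
        EuclideanSpace ℝ ι, exp (-U (ω + ψ')) ∂(multivariateGaussian 0 Γ)) ^ 2)⁻¹ * (∫ ω : EuclideanSpace ℝ ι, exp (-U (ω + ψ')) * U' (ω + ψ') k
        ∂(multivariateGaussian 0 Γ)) * (∫ ω : EuclideanSpace ℝ ι, exp (-U (ω + ψ')) * (U'' (ω + ψ') h l - U' (ω + ψ') h * U' (ω + ψ') l)
        ∂(multivariateGaussian 0 Γ)) + (((∫ ω : EuclideanSpace ℝ ι, exp (-U (ω + ψ')) ∂(multivariateGaussian 0 Γ)) ^ 2)⁻¹ * (∫ ω : EuclideanSpace ℝ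
        ι, exp (-U (ω + ψ')) * (U'' (ω + ψ') h k - U' (ω + ψ') h * U' (ω + ψ') k) ∂(multivariateGaussian 0 Γ)) + -2 / (∫ ω : EuclideanSpace ℝ ι, exp
        (-U (ω + ψ')) ∂(multivariateGaussian 0 Γ)) ^ 3 * -(∫ ω : EuclideanSpace ℝ ι, exp (-U (ω + ψ')) * U' (ω + ψ') h ∂(multivariateGaussian 0 Γ))
        * (∫ ω : EuclideanSpace ℝ ι, exp (-U (ω + ψ')) * U' (ω + ψ') k ∂(multivariateGaussian 0 Γ))) * (∫ ω : EuclideanSpace ℝ ι, exp (-U (ω + ψ'))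
        * U' (ω + ψ') l ∂(multivariateGaussian 0 Γ))) ψ) (EuclideanSpace.single n (1 : ℝ))) ψ₀).smulRight (EuclideanSpace.proj n : EuclideanSpace ℝ
        ι →L[ℝ] ℝ)) ψ₀ := by
  have hU₄c : Continuous U₄ := continuous_iff_continuousAt.2 fun φ => (hU₄d φ).continuousAt
  have hn1 : ∀ n : ι, ‖(EuclideanSpace.single n (1 : ℝ) : EuclideanSpace ℝ ι)‖ ≤ 1 := fun n => by
    simp
  have hg : ∀ n : ι, DifferentiableAt ℝ (fun ψ : EuclideanSpace ℝ ι => (fderiv ℝ (fun ψ' : EuclideanSpace ℝ ι => ((∫ ω : EuclideanSpace ℝ ι, exp (-U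
      (ω + ψ')) ∂(multivariateGaussian 0 Γ)))⁻¹ * (∫ ω : EuclideanSpace ℝ ι, exp (-U (ω + ψ')) * (U₃ (ω + ψ') h k l - U' (ω + ψ') k * U'' (ω + ψ') h
      l - U'' (ω + ψ') h k * U' (ω + ψ') l - U' (ω + ψ') h * U'' (ω + ψ') k l + U' (ω + ψ') h * U' (ω + ψ') k * U' (ω + ψ') l)
      ∂(multivariateGaussian 0 Γ)) + ((∫ ω : EuclideanSpace ℝ ι, exp (-U (ω + ψ')) ∂(multivariateGaussian 0 Γ)) ^ 2)⁻¹ * (∫ ω : EuclideanSpace ℝ ι,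
      exp (-U (ω + ψ')) * U' (ω + ψ') h ∂(multivariateGaussian 0 Γ)) * (∫ ω : EuclideanSpace ℝ ι, exp (-U (ω + ψ')) * (U'' (ω + ψ') k l - U' (ω +
      ψ') k * U' (ω + ψ') l) ∂(multivariateGaussian 0 Γ)) + ((∫ ω : EuclideanSpace ℝ ι, exp (-U (ω + ψ')) ∂(multivariateGaussian 0 Γ)) ^ 2)⁻¹ * (∫ ω
      : EuclideanSpace ℝ ι, exp (-U (ω + ψ')) * U' (ω + ψ') k ∂(multivariateGaussian 0 Γ)) * (∫ ω : EuclideanSpace ℝ ι, exp (-U (ω + ψ')) * (U'' (ω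
      + ψ') h l - U' (ω + ψ') h * U' (ω + ψ') l) ∂(multivariateGaussian 0 Γ)) + (((∫ ω : EuclideanSpace ℝ ι, exp (-U (ω + ψ'))
      ∂(multivariateGaussian 0 Γ)) ^ 2)⁻¹ * (∫ ω : EuclideanSpace ℝ ι, exp (-U (ω + ψ')) * (U'' (ω + ψ') h k - U' (ω + ψ') h * U' (ω + ψ') k)
      ∂(multivariateGaussian 0 Γ)) + -2 / (∫ ω : EuclideanSpace ℝ ι, exp (-U (ω + ψ')) ∂(multivariateGaussian 0 Γ)) ^ 3 * -(∫ ω : EuclideanSpace ℝ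
      ι, exp (-U (ω + ψ')) * U' (ω + ψ') h ∂(multivariateGaussian 0 Γ)) * (∫ ω : EuclideanSpace ℝ ι, exp (-U (ω + ψ')) * U' (ω + ψ') k
      ∂(multivariateGaussian 0 Γ))) * (∫ ω : EuclideanSpace ℝ ι, exp (-U (ω + ψ')) * U' (ω + ψ') l ∂(multivariateGaussian 0 Γ))) ψ)
      (EuclideanSpace.single n (1 : ℝ))) ψ₀ := fun n =>
    (differentiableAt_fourth_form hΓ hΓop Y hUd hU'd hU''d hU₃d hU₄d hU₅c hκ₀ hκ₁ ha hτ hδ hθ1 hκθ hstab hU'b hθ0 hU''b hU₃b hU₄b hU₅b ψ₀ hh hk hl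
      (hn1 n)).congr_of_eventuallyEq
      (Filter.Eventually.of_forall fun ψ => fderiv_third_form_apply hΓ hΓop Y hUd hU'd hU''d hU₃d hU₄c hκ₀ hκ₁ ha hτ hδ hθ1 hκθ hstab hU'b hθ0
      hU''b hU₃b hU₄b ψ hh hk hl (EuclideanSpace.single n (1 : ℝ)))
  have hexp : (fun ψ : EuclideanSpace ℝ ι => fderiv ℝ (fun ψ' : EuclideanSpace ℝ ι => ((∫ ω : EuclideanSpace ℝ ι, exp (-U (ω + ψ'))
      ∂(multivariateGaussian 0 Γ)))⁻¹ * (∫ ω : EuclideanSpace ℝ ι, exp (-U (ω + ψ')) * (U₃ (ω + ψ') h k l - U' (ω + ψ') k * U'' (ω + ψ') h l - U''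
      (ω + ψ') h k * U' (ω + ψ') l - U' (ω + ψ') h * U'' (ω + ψ') k l + U' (ω + ψ') h * U' (ω + ψ') k * U' (ω + ψ') l) ∂(multivariateGaussian 0 Γ))
      + ((∫ ω : EuclideanSpace ℝ ι, exp (-U (ω + ψ')) ∂(multivariateGaussian 0 Γ)) ^ 2)⁻¹ * (∫ ω : EuclideanSpace ℝ ι, exp (-U (ω + ψ')) * U' (ω +
      ψ') h ∂(multivariateGaussian 0 Γ)) * (∫ ω : EuclideanSpace ℝ ι, exp (-U (ω + ψ')) * (U'' (ω + ψ') k l - U' (ω + ψ') k * U' (ω + ψ') l)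
      ∂(multivariateGaussian 0 Γ)) + ((∫ ω : EuclideanSpace ℝ ι, exp (-U (ω + ψ')) ∂(multivariateGaussian 0 Γ)) ^ 2)⁻¹ * (∫ ω : EuclideanSpace ℝ ι,
      exp (-U (ω + ψ')) * U' (ω + ψ') k ∂(multivariateGaussian 0 Γ)) * (∫ ω : EuclideanSpace ℝ ι, exp (-U (ω + ψ')) * (U'' (ω + ψ') h l - U' (ω +
      ψ') h * U' (ω + ψ') l) ∂(multivariateGaussian 0 Γ)) + (((∫ ω : EuclideanSpace ℝ ι, exp (-U (ω + ψ')) ∂(multivariateGaussian 0 Γ)) ^ 2)⁻¹ * (∫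
      ω : EuclideanSpace ℝ ι, exp (-U (ω + ψ')) * (U'' (ω + ψ') h k - U' (ω + ψ') h * U' (ω + ψ') k) ∂(multivariateGaussian 0 Γ)) + -2 / (∫ ω :
      EuclideanSpace ℝ ι, exp (-U (ω + ψ')) ∂(multivariateGaussian 0 Γ)) ^ 3 * -(∫ ω : EuclideanSpace ℝ ι, exp (-U (ω + ψ')) * U' (ω + ψ') h
      ∂(multivariateGaussian 0 Γ)) * (∫ ω : EuclideanSpace ℝ ι, exp (-U (ω + ψ')) * U' (ω + ψ') k ∂(multivariateGaussian 0 Γ))) * (∫ ω :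
      EuclideanSpace ℝ ι, exp (-U (ω + ψ')) * U' (ω + ψ') l ∂(multivariateGaussian 0 Γ))) ψ) = fun ψ : EuclideanSpace ℝ ι => ∑ n : ι, ((fderiv ℝ
      (fun ψ' : EuclideanSpace ℝ ι => ((∫ ω : EuclideanSpace ℝ ι, exp (-U (ω + ψ')) ∂(multivariateGaussian 0 Γ)))⁻¹ * (∫ ω : EuclideanSpace ℝ ι, exp
      (-U (ω + ψ')) * (U₃ (ω + ψ') h k l - U' (ω + ψ') k * U'' (ω + ψ') h l - U'' (ω + ψ') h k * U' (ω + ψ') l - U' (ω + ψ') h * U'' (ω + ψ') k l +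
      U' (ω + ψ') h * U' (ω + ψ') k * U' (ω + ψ') l) ∂(multivariateGaussian 0 Γ)) + ((∫ ω : EuclideanSpace ℝ ι, exp (-U (ω + ψ'))
      ∂(multivariateGaussian 0 Γ)) ^ 2)⁻¹ * (∫ ω : EuclideanSpace ℝ ι, exp (-U (ω + ψ')) * U' (ω + ψ') h ∂(multivariateGaussian 0 Γ)) * (∫ ω :
      EuclideanSpace ℝ ι, exp (-U (ω + ψ')) * (U'' (ω + ψ') k l - U' (ω + ψ') k * U' (ω + ψ') l) ∂(multivariateGaussian 0 Γ)) + ((∫ ω :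
      EuclideanSpace ℝ ι, exp (-U (ω + ψ')) ∂(multivariateGaussian 0 Γ)) ^ 2)⁻¹ * (∫ ω : EuclideanSpace ℝ ι, exp (-U (ω + ψ')) * U' (ω + ψ') k
      ∂(multivariateGaussian 0 Γ)) * (∫ ω : EuclideanSpace ℝ ι, exp (-U (ω + ψ')) * (U'' (ω + ψ') h l - U' (ω + ψ') h * U' (ω + ψ') l)
      ∂(multivariateGaussian 0 Γ)) + (((∫ ω : EuclideanSpace ℝ ι, exp (-U (ω + ψ')) ∂(multivariateGaussian 0 Γ)) ^ 2)⁻¹ * (∫ ω : EuclideanSpace ℝ ι,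
      exp (-U (ω + ψ')) * (U'' (ω + ψ') h k - U' (ω + ψ') h * U' (ω + ψ') k) ∂(multivariateGaussian 0 Γ)) + -2 / (∫ ω : EuclideanSpace ℝ ι, exp (-U
      (ω + ψ')) ∂(multivariateGaussian 0 Γ)) ^ 3 * -(∫ ω : EuclideanSpace ℝ ι, exp (-U (ω + ψ')) * U' (ω + ψ') h ∂(multivariateGaussian 0 Γ)) * (∫ ω
      : EuclideanSpace ℝ ι, exp (-U (ω + ψ')) * U' (ω + ψ') k ∂(multivariateGaussian 0 Γ))) * (∫ ω : EuclideanSpace ℝ ι, exp (-U (ω + ψ')) * U' (ω +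
      ψ') l ∂(multivariateGaussian 0 Γ))) ψ) (EuclideanSpace.single n (1 : ℝ))) • (EuclideanSpace.proj n : EuclideanSpace ℝ ι →L[ℝ] ℝ) := by
    funext ψ; exact covector_expand _
  rw [hexp]
  exact HasFDerivAt.fun_sum fun n _ => (hg n).hasFDerivAt.smul_const (EuclideanSpace.proj n : EuclideanSpace ℝ ι →L[ℝ] ℝ)

end Main

/-! ## §3. Toy -/

/-- Toy (§2's mechanism in one dimension): a sum of `scalar • constant` is differentiated termwise. -/
example (c d : ℝ → ℝ) (c' d' x : ℝ) (hc : HasDerivAt c c' x) (hd : HasDerivAt d d' x) (u w : ℝ) :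
    HasDerivAt (fun y => c y • u + d y • w) (c' • u + d' • w) x :=
  (hc.smul_const u).add (hd.smul_const w)

end Summit.QuantumFields.BalabanUV.T4Continuum.NE7b.SupFourthFormCovectorFDeriv

end
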